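import Summits.SmoothPoincare4.SmoothPoincare4.Theorems.CongruenceShadowsNormalFormStablyTrivialSketchHandleSwap
import Literature.Topology.FourManifolds.SphereTrisections

/-!
# `NormalFormStablyTrivial` — line `Sketch`: CALIBRATION of stub K1 at the standard model (II)

Crux `CongruenceShadows.NormalFormStablyTrivial` (item stmt-SmoothPoincare4-14591, route
route-SmoothPoincare4-CongruenceShadows), line `Sketch`, stub K1 `StablyThreeHandleFree`
("after stabilising, a normalised trisection of `{1}` is isomorphic to `K'' # eyes r j`", the
kernel form of Kirby 4.18 for homotopy 4-spheres).  This file proves that the CONCLUSION of K1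
holds at the standard triple `K = N = s4Kernels.stabilizeIter M` with `n = 0`:

* `calibration` (registered sub-goal) — for every `M` and `r = M + 1`, the standard `(3+3M; M+1)`
  kernel triple of `S⁴`, transported along `3 + 3M = 2r + r`, is isomorphic (by ONE relator-fixing
  automorphism of the surface group — a handle permutation) to the connected sum of a genus-`2r`
  triple with the genus-`r` eye triple in direction `0`.

Consequences (companion file `…SketchConsequences.lean`, which needs the route file): Abrams–Gay–
Kirby's condition `X` ("every `(3k,k)` trisection of `{1}` is stably trivial", hence SPC4) implies
K1, so K1 is sandwiched `SPC4 ⇒ K1`, `K1 ∧ K2 ⇒ crux`; and K1 is not refutable "for silly reasons"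
(the failure mode of the sibling idea `simplified-tower`, whose typed first lemma was false at
`K = N`).

Route of proof.  §5: the one-direction `(r+1)`-fold unbalanced stabilisation of ANY triple is its
connected sum with the eye triple ON THE NOSE (`soIter_eq_connectSum_eyes`, from
`connectSum_stabilizeOne` — an unbalanced stabilisation of `K # L` happens in `L` — and
`eyes_succ`); §6: `N_M` is the pattern-list triple of `[0,1,2]^{M+1}` (`stabilizeIter_eq_patL`:
`stabilize_eq_stabilizeOne` block by block over `trivialKernels_stabilize`), that list is a
permutation of `0^{M+1} ++ [1,2]^{M+1}` (`perm_std`), permutations of pattern lists are realised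
by relator-fixing automorphisms (`exists_realiser_of_perm`, companion file I), and the pattern-list
triple of `0^{M+1} ++ l` is the one-direction stabilisation of that of `l` (`patL_replicate_append`).
Everything is explicit algebra; no named facts, no `sorry`.
References: D. Gay, R. Kirby, *Trisecting 4-manifolds*, Geom. Topol. 20 (2016), Lemma 10, §2;
A. Abrams, D. Gay, R. Kirby, Geom. Topol. 22 (2018), Def. 2–3.
-/

noncomputable section

-- the prescribed namespace `Summit.<P>.<Sub>.…` duplicates `SmoothPoincare4` (P = Sub)
set_option linter.dupNamespace false

namespace Summit.SmoothPoincare4.SmoothPoincare4.Theorems.NormalFormStablyTrivial.Sketch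

open Literature.Topology.FourManifolds Subgroup RelatorAut

variable {g g' : ℕ}

/-- The kernel triple of a PATTERN LIST (as in the companion file): starting from the genus-`0`
triple, stabilise once in direction `x` for each entry `x` of the list (head = last handle). -/
local notation3 "𝒫 " arg:max => (List.rec (motive := fun t => TrisectionKernels (List.length t))
  trivialKernels (fun hd _ K => TrisectionKernels.stabilizeOne K hd) arg)

/-! ## 5. One-direction stabilisations are connected sums with the eye triple -/

/-- The genus-`r` EYE TRIPLE in direction `j`: slot `j` kills `b₁,…,b_r`, the two other slots kill
`a₁,…,a_r` (written exactly as in the stub statements of the line). -/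
local notation3 "ℰ " r:max j:max => (fun ι : Fin 3 => normalClosure (Set.range fun i : Fin r =>
  (PresentedGroup.of (i, decide (ι = j)) : SurfaceGroup r)))

/-- Two normal closures agree when each generating set lies in the other closure. [folklore] -/
theorem normalClosure_eq_of_forall_mem {G : Type*} [Group G] {S T : Set G}
    (h1 : ∀ x ∈ S, x ∈ normalClosure T) (h2 : ∀ y ∈ T, y ∈ normalClosure S) :
    normalClosure S = normalClosure T :=
  le_antisymm (normalClosure_le_normal h1) (normalClosure_le_normal h2)

/-- The preimage of a slot of the eye triple in the free group: the normal closure of the killed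
generators and the relator. [folklore] -/
theorem preimage_mk_eyes (r : ℕ) (j ι : Fin 3) :
    (PresentedGroup.mk _) ⁻¹' ((ℰ r j) ι : Set (SurfaceGroup r)) =
      (normalClosure (Set.range (fun i : Fin r => FreeGroup.of ((i, decide (ι = j)) : surfaceGen r)) ∪
          {surfaceRelator r}) : Set (FreeGroup (surfaceGen r))) := by
  have : (ℰ r j) ι = normalClosure ((PresentedGroup.mk _) ''
      Set.range (fun i : Fin r => FreeGroup.of ((i, decide (ι = j)) : surfaceGen r))) := by
    show normalClosure _ = _
    rw [← Set.range_comp]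
    rfl
  rw [this, ← Subgroup.coe_comap, comap_mk_normalClosure_image]

/-- `r_n` lifts `1 ∈ K_ι`. [folklore] -/
theorem surfaceRelator_mem_preimage {n : ℕ} (N : Subgroup (SurfaceGroup n)) :
    surfaceRelator n ∈ (PresentedGroup.mk _) ⁻¹' (N : Set (SurfaceGroup n)) := by
  have h0 : PresentedGroup.mk ({surfaceRelator n} : Set (FreeGroup (surfaceGen n)))
      (surfaceRelator n) = 1 :=
    (PresentedGroup.mk_eq_one_iff).2 (subset_normalClosure (Set.mem_singleton _))
  rw [Set.mem_preimage, SetLike.mem_coe, h0]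
  exact one_mem _

/-- Preimage of a slot of a connected sum in the free group (no normality needed). [folklore] -/
theorem preimage_mk_connectSum' {n m : ℕ} (K : TrisectionKernels n) (L : TrisectionKernels m) (ι : Fin 3) :
    (PresentedGroup.mk _) ⁻¹' (K.connectSum L ι : Set (SurfaceGroup (n + m))) =
      (normalClosure (genInclAdd n m '' ((PresentedGroup.mk _) ⁻¹' (K ι : Set (SurfaceGroup n))) ∪
          genShiftAdd n m '' ((PresentedGroup.mk _) ⁻¹' (L ι : Set (SurfaceGroup m))) ∪
          {surfaceRelator (n + m)}) : Set (FreeGroup (surfaceGen (n + m)))) := by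
  rw [TrisectionKernels.connectSum_apply, Set.image_comp, Set.image_comp, ← Set.image_union,
    ← Subgroup.coe_comap, comap_mk_normalClosure_image]

/-- `ι₁ ∘ ι = ι'`: the first `n` handles of `(n + m) + 1 = n + (m + 1)`. [folklore] -/
theorem genInclAdd_comp_genInclAdd' (n m : ℕ) :
    (genInclAdd (n + m) 1).comp (genInclAdd n m) = genInclAdd n (m + 1) := by
  refine FreeGroup.ext_hom _ _ fun p => ?_
  simp only [MonoidHom.comp_apply, genInclAdd_of]
  congr 1

/-- `ι₁ ∘ σ = σ' ∘ ι`: the middle `m` handles of `(n + m) + 1 = n + (m + 1)`. [folklore] -/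
theorem genInclAdd_comp_genShiftAdd (n m : ℕ) :
    (genInclAdd (n + m) 1).comp (genShiftAdd n m) = (genShiftAdd n (m + 1)).comp (genInclAdd m 1) := by
  refine FreeGroup.ext_hom _ _ fun p => ?_
  simp only [MonoidHom.comp_apply, genInclAdd_of, genShiftAdd_of]
  congr 1

/-- `σ₁ (x₀) = σ' (σ (x₀))`: the last handle of `(n + m) + 1 = n + (m + 1)`. [folklore] -/
theorem genShiftAdd_of_zero_eq (n m : ℕ) (b : Bool) :
    genShiftAdd (n + m) 1 (FreeGroup.of (((0 : Fin 1), b) : surfaceGen 1)) =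
      genShiftAdd n (m + 1) (genShiftAdd m 1 (FreeGroup.of (((0 : Fin 1), b) : surfaceGen 1))) := by
  simp only [genShiftAdd_of]
  congr 1

/-- **Unbalanced stabilisation of a connected sum happens in the second summand**:
`(K # L).stabilizeOne j = K # (L.stabilizeOne j)` on the nose (genus `(n + m) + 1 = n + (m + 1)`
definitionally); both sides are the normal closure of the lifts of `K_ι`, of `L_ι` and of the new
generator, the intermediate relators being absorbed. [folklore] -/
theorem connectSum_stabilizeOne {n m : ℕ} (K : TrisectionKernels n) (L : TrisectionKernels m)
    (j ι : Fin 3) : (K.connectSum L).stabilizeOne j ι = K.connectSum (L.stabilizeOne j) ι := by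
  -- left-hand side, flattened
  rw [(K.connectSum L).stabilizeOne_apply_eq j ι, preimage_mk_connectSum', ← MonoidHom.coe_comp,
    normalClosure_image_normalClosure_union]
  -- right-hand side, flattened
  rw [K.connectSum_apply_eq_of_preimage_eq (L.stabilizeOne j) ι (L.preimage_mk_stabilizeOne j ι)]
  have hιι : ∀ u, genInclAdd (n + m) 1 (genInclAdd n m u) = genInclAdd n (m + 1) u :=
    fun u => DFunLike.congr_fun (genInclAdd_comp_genInclAdd' n m) u
  have hισ : ∀ v, genInclAdd (n + m) 1 (genShiftAdd n m v) = genShiftAdd n (m + 1) (genInclAdd m 1 v) :=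
    fun v => DFunLike.congr_fun (genInclAdd_comp_genShiftAdd n m) v
  refine normalClosure_eq_of_forall_mem ?_ ?_
  · rintro x (⟨w, ((⟨u, hu, rfl⟩ | ⟨v, hv, rfl⟩) | rfl), rfl⟩ | rfl)
    · refine subset_normalClosure (Or.inl ⟨u, hu, ?_⟩)
      (simp only [Function.comp_apply, MonoidHom.coe_comp, hιι]; rfl)
    · refine subset_normalClosure (Or.inr ⟨genInclAdd m 1 v, Or.inl (Or.inl ⟨v, hv, rfl⟩), ?_⟩)
      (simp only [Function.comp_apply, MonoidHom.coe_comp, hισ]; rfl)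
    · -- the relator of the middle level: `ι₁ r_{n+m} = (σ₁ r_1)⁻¹`, and `σ₁ r_1 ∈ ⟪new generator⟫`
      rw [MonoidHom.coe_comp, Function.comp_apply,
        eq_inv_of_mul_eq_one_left (mk_genInclAdd_surfaceRelator_mul_mk_genShiftAdd (n + m) 1)]
      refine inv_mem (normalClosure_mono ?_ (map_surfaceRelator_one_mem_normalClosure
        ((PresentedGroup.mk _).comp (genShiftAdd (n + m) 1)) (decide (ι = j))))
      rintro _ rfl
      refine Or.inr ⟨_, Or.inl (Or.inr rfl), ?_⟩
      (simp only [Function.comp_apply, MonoidHom.coe_comp, genShiftAdd_of_zero_eq]; rfl)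
    · refine subset_normalClosure (Or.inr ⟨_, Or.inl (Or.inr rfl), ?_⟩)
      (simp only [Function.comp_apply, genShiftAdd_of_zero_eq]; rfl)
  · rintro y (⟨u, hu, rfl⟩ | ⟨w, ((⟨v, hv, rfl⟩ | rfl) | rfl), rfl⟩)
    · refine subset_normalClosure (Or.inl ⟨genInclAdd n m u, Or.inl (Or.inl ⟨u, hu, rfl⟩), ?_⟩)
      (simp only [Function.comp_apply, MonoidHom.coe_comp, hιι]; rfl)
    · refine subset_normalClosure (Or.inl ⟨genShiftAdd n m v, Or.inl (Or.inr ⟨v, hv, rfl⟩), ?_⟩)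
      (simp only [Function.comp_apply, MonoidHom.coe_comp, hισ]; rfl)
    · refine subset_normalClosure (Or.inr ?_)
      (simp only [Function.comp_apply, Set.mem_singleton_iff, genShiftAdd_of_zero_eq]; rfl)
    · -- the relator of the new block: `σ' r_{m+1} = (ι' r_n)⁻¹`, and `r_n` lifts `1 ∈ K_ι`
      rw [Function.comp_apply,
        eq_inv_of_mul_eq_one_right (mk_genInclAdd_surfaceRelator_mul_mk_genShiftAdd n (m + 1))]
      refine inv_mem (subset_normalClosure (Or.inl ⟨genInclAdd n m (surfaceRelator n),
        Or.inl (Or.inl ⟨_, surfaceRelator_mem_preimage (K ι), rfl⟩), ?_⟩))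
      (simp only [Function.comp_apply, MonoidHom.coe_comp, hιι]; rfl)

/-- **The eye triple grows by one eye under unbalanced stabilisation in its own direction.**
[folklore] -/
theorem eyes_succ (r : ℕ) (j : Fin 3) : TrisectionKernels.stabilizeOne (ℰ r j) j = ℰ (r + 1) j := by
  funext ι
  rw [TrisectionKernels.stabilizeOne_apply_eq, preimage_mk_eyes, ← MonoidHom.coe_comp,
    normalClosure_image_normalClosure_union]
  refine normalClosure_eq_of_forall_mem ?_ ?_
  · rintro x (⟨w, (⟨i, rfl⟩ | rfl), rfl⟩ | rfl)
    · refine subset_normalClosure ⟨Fin.castSucc i, ?_⟩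
      simp only [MonoidHom.coe_comp, Function.comp_apply, genInclAdd_of]
      rfl
    · -- the old relator `ι r_r = (σ r_1)⁻¹ ∈ ⟪new generator⟫`
      rw [MonoidHom.coe_comp, Function.comp_apply,
        eq_inv_of_mul_eq_one_left (mk_genInclAdd_surfaceRelator_mul_mk_genShiftAdd r 1)]
      refine inv_mem (normalClosure_mono ?_ (map_surfaceRelator_one_mem_normalClosure
        ((PresentedGroup.mk _).comp (genShiftAdd r 1)) (decide (ι = j))))
      rintro _ rfl
      refine ⟨Fin.last r, ?_⟩
      simp only [MonoidHom.coe_comp, Function.comp_apply, genShiftAdd_of]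
      rfl
    · refine subset_normalClosure ⟨Fin.last r, ?_⟩
      simp only [genShiftAdd_of]
      rfl
  · rintro y ⟨i, rfl⟩
    rcases Fin.eq_castSucc_or_eq_last i with ⟨i, rfl⟩ | rfl
    · refine subset_normalClosure (Or.inl ⟨FreeGroup.of ((i, decide (ι = j)) : surfaceGen r),
        Or.inl ⟨i, rfl⟩, ?_⟩)
      simp only [MonoidHom.coe_comp, Function.comp_apply, genInclAdd_of]
      rfl
    · refine subset_normalClosure (Or.inr ?_)
      simp only [Set.mem_singleton_iff, genShiftAdd_of]
      rfl

/-- The eye triple at `r = 1` is `unbalancedKernels j`. [folklore] -/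
theorem eyes_one_eq (j : Fin 3) : ℰ 1 j = unbalancedKernels j := by
  funext ι
  rw [unbalancedKernels_apply]
  congr 1
  ext x
  simp only [Set.mem_range, Set.mem_singleton_iff]
  constructor
  · rintro ⟨i, rfl⟩
    rw [Fin.fin_one_eq_zero i]
  · rintro rfl
    exact ⟨0, rfl⟩

/-- **Iterated unbalanced stabilisation in one direction is the connected sum with the eye triple**:
`(((K.stabilizeOne j).stabilizeOne j)⋯)` (`r + 1` eyes) `= K # eyes (r+1) j` on the nose. [folklore] -/
theorem soIter_eq_connectSum_eyes {n : ℕ} (K : TrisectionKernels n) (j : Fin 3) :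
    ∀ r : ℕ, (Nat.rec (motive := fun r => TrisectionKernels (n + (r + 1))) (K.stabilizeOne j)
        (fun _ L => L.stabilizeOne j) r) = K.connectSum (ℰ (r + 1) j)
  | 0 => by
    show K.stabilizeOne j = _
    rw [eyes_one_eq]
    rfl
  | r + 1 => by
    show TrisectionKernels.stabilizeOne (Nat.rec (motive := fun r => TrisectionKernels (n + (r + 1)))
      (K.stabilizeOne j) (fun _ L => L.stabilizeOne j) r) j = _
    rw [soIter_eq_connectSum_eyes K j r, ← eyes_succ (r + 1) j]
    funext ι
    exact connectSum_stabilizeOne K _ j ι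

/-- The pattern-list triple of `j^{r+1} ++ l` is the `(r+1)`-fold direction-`j` stabilisation of
that of `l` (transported along the length bookkeeping). [folklore] -/
theorem patL_replicate_append (j : Fin 3) (l : List (Fin 3)) :
    ∀ r : ℕ, ∃ h : (List.replicate (r + 1) j ++ l).length = l.length + (r + 1),
      (𝒫 (List.replicate (r + 1) j ++ l)).cast h =
        Nat.rec (motive := fun r => TrisectionKernels (l.length + (r + 1))) ((𝒫 l).stabilizeOne j)
          (fun _ L => L.stabilizeOne j) r
  | 0 => ⟨by simp, rfl⟩
  | r + 1 => by
    obtain ⟨h, ih⟩ := patL_replicate_append j l r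
    refine ⟨by simp; omega, ?_⟩
    show ((𝒫 (List.replicate (r + 1) j ++ l)).stabilizeOne j).cast _ = TrisectionKernels.stabilizeOne _ j
    rw [cast_stabilizeOne h, ih]

/-! ## 6. The standard triple is a one-direction connected sum: calibration of K1 at `K = N` -/

/-- The pattern list of the standard `(3+3M; M+1)` triple: `M+1` blocks `[0,1,2]`. -/
local notation3 "𝓈 " arg:max => (Nat.rec (motive := fun _ => List (Fin 3)) [0, 1, 2]
  (fun _ t => (0 :: 1 :: 2 :: t)) arg)

/-- The pattern list of the complementary genus-`2(M+1)` triple: `M+1` blocks `[1,2]`. -/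
local notation3 "𝓀 " arg:max => (Nat.rec (motive := fun _ => List (Fin 3)) [1, 2]
  (fun _ t => (1 :: 2 :: t)) arg)

/-- Length of `𝓈 M`. [folklore] -/
theorem length_std : ∀ M : ℕ, (𝓈 M).length = 3 + 3 * M
  | 0 => rfl
  | M + 1 => by
    show (0 :: 1 :: 2 :: 𝓈 M).length = _
    simp only [List.length_cons, length_std M]
    omega

/-- Length of `𝓀 M`. [folklore] -/
theorem length_kl : ∀ M : ℕ, (𝓀 M).length = 2 + 2 * M
  | 0 => rfl
  | M + 1 => by
    show (1 :: 2 :: 𝓀 M).length = _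
    simp only [List.length_cons, length_kl M]
    omega

/-- **The standard triple is a pattern-list triple**: `N_M = s4Kernels.stabilizeIter M` is the
iterated unbalanced stabilisation of the genus-`0` triple along `𝓈 M` (`stabilize_eq_stabilizeOne`
block by block, `trivialKernels_stabilize` at the bottom). [folklore] -/
theorem stabilizeIter_eq_patL : ∀ M : ℕ, ∃ h : (𝓈 M).length = 3 + 3 * M,
    s4Kernels.stabilizeIter M = (𝒫 (𝓈 M)).cast h
  | 0 => ⟨rfl, by
      show s4Kernels = ((trivialKernels.stabilizeOne 2).stabilizeOne 1).stabilizeOne 0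
      rw [← TrisectionKernels.stabilize_eq_stabilizeOne, trivialKernels_stabilize]⟩
  | M + 1 => by
    obtain ⟨h, ih⟩ := stabilizeIter_eq_patL M
    refine ⟨(length_std (M + 1)), ?_⟩
    -- transport commutes with the balanced stabilisation (`stabilize_cast` of `DownwardClosed.lean`,
    -- restated locally to keep this file independent of the route file)
    have hsc : ∀ {g₁ g₂ : ℕ} (h : g₁ = g₂) (h' : g₁ + 3 = g₂ + 3) (K : TrisectionKernels g₁),
        (K.cast h).stabilize = K.stabilize.cast h' := by
      intro g₁ g₂ h h' K; subst h; rfl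
    show (s4Kernels.stabilizeIter M).stabilize = ((((𝒫 (𝓈 M)).stabilizeOne 2).stabilizeOne 1).stabilizeOne 0).cast _
    rw [ih, hsc h, TrisectionKernels.stabilize_eq_stabilizeOne]

/-- The handle permutation: `𝓈 M` is a permutation of `0^{M+1} ++ 𝓀 M`. [folklore] -/
theorem perm_std : ∀ M : ℕ, (𝓈 M).Perm (List.replicate (M + 1) 0 ++ 𝓀 M)
  | 0 => List.Perm.refl _
  | M + 1 => by
    have h1 : (List.replicate (M + 1) 0 ++ 1 :: 2 :: 𝓀 M).Perm (1 :: 2 :: (List.replicate (M + 1) 0 ++ 𝓀 M)) :=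
      List.perm_middle.trans (List.Perm.cons 1 List.perm_middle)
    show (0 :: 1 :: 2 :: 𝓈 M).Perm (0 :: (List.replicate (M + 1) 0 ++ 1 :: 2 :: 𝓀 M))
    exact (((perm_std M).cons 2).cons 1).trans h1.symm |>.cons 0

/-- Transport on the left summand of a connected sum. [folklore] -/
theorem cast_connectSum_left {n n' m : ℕ} (h : n = n') (h' : n + m = n' + m) (K : TrisectionKernels n)
    (L : TrisectionKernels m) : (K.cast h).connectSum L = (K.connectSum L).cast h' := by
  subst h; rfl

/-- **CALIBRATION (stub K1 at the standard model).**  For every `M`, the standard `(3+3M; M+1)`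
kernel triple of `S⁴`, transported along `3 + 3M = 2r + r` (`r = M + 1`), is isomorphic — by one
relator-fixing automorphism of the surface group, a handle permutation — to the connected sum of a
genus-`2r` triple with the genus-`r` eye triple in direction `0`: the conclusion of
`StablyThreeHandleFree` holds at `K = N` with `n = 0`. [folklore] -/
theorem calibration (M r : ℕ) (hr : r = M + 1) (h : 3 + 3 * M = 2 * r + r) :
    ∃ K'' : TrisectionKernels (2 * r),
      TrisectionKernels.Iso ((s4Kernels.stabilizeIter M).cast h)
        (K''.connectSum (fun ι : Fin 3 => normalClosure (Set.range fun i : Fin r =>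
          (PresentedGroup.of (i, decide (ι = 0)) : SurfaceGroup r)))) := by
  subst hr
  -- transport of a transport (`cast_cast` of `DownwardClosed.lean`, restated locally)
  have cast_cast' : ∀ {g₁ g₂ g₃ : ℕ} (K : TrisectionKernels g₁) (h : g₁ = g₂) (h' : g₂ = g₃),
      (K.cast h).cast h' = K.cast (h.trans h') := by
    intro g₁ g₂ g₃ K h h'; subst h; subst h'; rfl
  obtain ⟨h₁, hN⟩ := stabilizeIter_eq_patL M
  obtain ⟨A, hA⟩ := exists_realiser_of_perm (perm_std M)
  obtain ⟨h₃, hP⟩ := patL_replicate_append 0 (𝓀 M) M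
  have hK : (𝓀 M).length = 2 * (M + 1) := by rw [length_kl]; ring
  have h₅ : (List.replicate (M + 1) 0 ++ 𝓀 M).length = 2 * (M + 1) + (M + 1) := by
    rw [h₃, hK]
  obtain ⟨A', hA'⟩ := exists_realiser_cast h₅ ⟨A, hA⟩
  refine ⟨(𝒫 (𝓀 M)).cast hK, A'.toMulEquiv, fun ι => ?_⟩
  rw [cast_connectSum_left hK (by rw [hK]), ← soIter_eq_connectSum_eyes, ← hP, cast_cast', hN,
    cast_cast']
  rw [cast_cast'] at hA'
  exact hA' ι

end Summit.SmoothPoincare4.SmoothPoincare4.Theorems.NormalFormStablyTrivial.Sketch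

end
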